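import Literature.MathematicalPhysics.QuantumFieldTheory.Balaban1983to89.B1Eq324BenfattoKernelSect5Eq513
import Literature.MathematicalPhysics.QuantumFieldTheory.Balaban1983to89.B1Eq324BenfattoKernelComparison
import Literature.MathematicalPhysics.QuantumFieldTheory.Balaban1983to89.B1Eq324BenfattoKernelSect5Termination
import Literature.MathematicalPhysics.QuantumFieldTheory.Balaban1983to89.B1Eq324BenfattoSect5Eq515
import Literature.MathematicalPhysics.QuantumFieldTheory.Balaban1983to89.B1Eq324BenfattoSpecialisation
import Literature.MathematicalPhysics.QuantumFieldTheory.Balaban1983to89.B1Eq324BenfattoSect5ErrTermLedger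
import HarnessLib

/-!
# `Balaban1983to89.B1Eq324BenfattoClassCollar` — [BenfattoEtAl1978] Lemma (4.6)–(4.7) p. 152 is stated on `ℤ^d` (no boundary); for OUR class form
# ([Balaban1985BackgroundPropagators] Sect. E p. 428: members `(Λ, A)` on a FINITE `Λ ⊂ ℤ^d`) the §5 port asks the support of `H_J` to sit a
# pavement side deep inside `Λ` («pad»).  THE INDEPENDENT COLLAR removes that restriction: pad the member by an independent block, apply the class
# Basic Lemma there, TRANSFER the two-sided sandwich back — PROVED, no definition

statement-level skeleton of published theorems with citation tags; proofs where landed; nothing here is a claim about the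
Yang–Mills mass gap

WHY THIS MODULE (cell `pub-ymgap`, seat `dag-n08-d` gen 14, CLAIM-71; node N08 [Balaban1985UV3]; answer to seat n08-w4's located CHECK B,
`N08-CLASS-SOCKET-PRESENTATION-g5.md` §3).  The class Basic-Lemma knit (seat n08-c, `…KernelSect5ClassBasicLemma.classBasicLemma_signed`) carries the
admissibility `hpad : ∀ x ∈ J, ∀ z, (∀ i, |z i − x i| ≤ b²) → z ∈ Λ` — the `b²`-thickening of `supp H_J` inside the member — because the per-box road's part
kernels are `(A|_{shrink □})⁻¹` with `□ ⊆ Λ` (`…KernelSect5PavementStep`, `…ClassLowerStep`).  At [B10]'s data `𝒱` has terms throughout the region, up to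
its boundary (n08-w4 §3 (α)), so `hpad` fails for the member itself.  REMEDY, with every landed file and the knit untouched: for a member `(Λ, A)` and ANY
`J ⊆ Λ` put `Λ′ := Λ ∪ P` with a finite collar `P ⊇ pad ∖ Λ` and `A′ := A ⊕ c·1_P` (block-diagonal, `c > 0`; take `c := γ_A`).  §1: `A′` is a member with
the SAME `γ_A` (if `γ_A ≤ c`), the same Combes–Thomas row `J_c` (the collar diagonal contributes `cosh 0 − 1 = 0`) and absolute rows `max M |c|`,
`max M₂ |c|` (growth rows are Λ-free, `…ClassEntryRows`), and `A′⁻¹ = A⁻¹ ⊕ c⁻¹·1_P`, i.e. `K′ = K + K_P` at kernel level; `hpad` holds in `Λ′` by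
construction, so the knit yields the sandwich for `𝒩(0, K′)`.  §§3–5 TRANSFER it to `𝒩(0, K)`: the cumulants of `H_J` agree (window law on `Λ`), the
cut-off exponential moment FACTORISES as `(∫Π_Δχ̂^I_b e^{H_J} d𝒩(0,K))·v_P` with `v_P` the collar's own small-field volume (independence across the
blocks, seat n08-d's `…KernelComparison` §4; a.s.-zero coordinates off the supports, `…KernelSect5Eq513`), and `e^{−|I|·4·8^d e^{−c b²/2}} ≤ v_P ≤ 1` by seat
n08-w5's class Appendix A — NOTE `|I|`, not `|P|`; the defect is absorbed into print's error term at the cost `S ↦ S + 4·8^d` once `√b ≥ 2ρ₃/c`.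

WHAT IS PROVED (standard axioms; no `sorry`; no definition — the collar member `A′` enters through four block hypotheses `hAA`/`hcross₁`/`hcross₂`/`hdiag`,
a consumer writes it with `Matrix.of` in five lines).
* §1 `symm_collar`, `coercive_collar`, `row_collar_le` (any two-point weight), ★ `inv_collar_apply`, ★ `kernel_collar_eq_add` (`K′ = K + c⁻¹·1_{Λ′∖Λ}`).
* §2 `integral_comp_restrict_eq_of_covGram_eq` (equal Gram block on a window ⇒ equal integrals of window observables).
* §3 kernel-level collar `K′ = K + K_P`: `covGram_collar_eq(_right)`, `collar_cross_eq_zero`, `collar_diag_eq_zero`, `hamiltonian_eq_comp_restrict`,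
  ★ `truncatedExp_collar_eq`, `cumulantSum_collar_eq`.
* §4 `mem_smallFieldSet_iff_of_vanish`, `cutoffBoltzmann_eq_mul_of_vanish`, ★★ `integral_cutoffBoltzmann_collar_eq_mul` (the factorisation).
* §5 `collarVolume_le_one`, ★ `exp_neg_le_collarVolume`, `collarDefect_le_errTerm` (with n08-c's `…Sect5ErrTermLedger.errTerm_add`), ★★★ `sandwich_of_collar_sandwich` (error `E ↦ E` below,
  `E + |I|·4·8^d·e^{−b²/(2C)}` above), ★★★ `sandwich_of_collar_sandwich_errTerm` (print's currency: `S ↦ S + 4·8^d`, the shape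
  `…Eq324Signed.eq324_of_sandwich_consts` eats).
* §6 ★★★ `isPosSemidefKernel_collarDiag`, `sandwich_of_collarMember_sandwich` — THE PACKAGE in the class theorems' letters: member `(Λ, A, K)`, collar member
  `(Λ′, A′, K′)` by the block hypotheses with `c > 0`, `J ⊆ Λ`, `I ≠ ∅`, `b² ≥ 4/c`, `√b ≥ 2ρ₃/c`, `ρ₄ ≥ 0`: sandwich for `𝒩(0,K′)` with `S` ⇒ sandwich for
  `𝒩(0,K)` with `S + 4·8^d`, same `(s, I, J, a, b, t)`.
HONEST SCOPE.  The collar, the class and the transfer are OURS (print works on `ℤ^d`); the (4.6) side with `C ≠ ∅` transfers the same way (`C ⊆ Λ` untouched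
by the collar) but is not typed here — row `h324` needs only the `C = ∅` sandwich; nothing of [Balaban1985UV3]/[Balaban1985UV2] is asserted; the IDENT at
[B10]'s data is NOT claimed (seat n08-w4's CHECK C — wrapped regions of the torus — is untouched by the collar); count-neutral for N08; nothing about
d = 4, the continuum, OS axioms, a mass gap or the Clay problem.
-/

noncomputable section

open MeasureTheory ProbabilityTheory Finset Matrix
open scoped BigOperators

namespace Literature.MathematicalPhysics.QuantumFieldTheory.Balaban1983to89.B1Eq324BenfattoClassCollar

open Literature.MathematicalPhysics.QuantumFieldTheory
open Literature.MathematicalPhysics.QuantumFieldTheory.GaussianToolkit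
open Literature.MathematicalPhysics.QuantumFieldTheory.Balaban1983to89.B1Eq324BenfattoLemma
open Literature.MathematicalPhysics.QuantumFieldTheory.Balaban1983to89.B1Eq324BenfattoKernelOfPrecision (isPosSemidefKernel_kernel)
open Literature.MathematicalPhysics.QuantumFieldTheory.Balaban1983to89.B1Eq324BenfattoKernelSect5Eq513 (ae_forall_eval_eq_zero)
open Literature.MathematicalPhysics.QuantumFieldTheory.Balaban1983to89.B1Eq324BenfattoKernelComparison (integral_comp_restrict_eq
  integral_prod_eq_prod_integral_shift)
open Literature.MathematicalPhysics.QuantumFieldTheory.Balaban1983to89.B1Eq324BenfattoKernelSect5Termination (integral_cutoffBoltzmann_empty_measure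
  integral_cutoffBoltzmann_empty_ge_of_kernel_translate)
open Literature.MathematicalPhysics.QuantumFieldTheory.Balaban1983to89.B1Eq324BenfattoAppendixA (distToRegion_nonneg)
open Literature.MathematicalPhysics.QuantumFieldTheory.Balaban1983to89.B1Eq324BenfattoSect5Eq515 (hamiltonian_congr_eqOn measurable_hamiltonian)
open Literature.MathematicalPhysics.QuantumFieldTheory.Balaban1983to89.B1Eq324BenfattoSect5Termination (hamiltonian_empty)
open Literature.MathematicalPhysics.QuantumFieldTheory.Balaban1983to89.B1Eq324BenfattoSect5ErrTermLedger (errTerm_add)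

variable {d : ℕ}

/-! ## §1  The collar member: `A′ = A ⊕ c·1` on `Λ′ ⊇ Λ` (block-diagonal), described by hypotheses -/

section Block

variable {Λ Λ' : Finset (B1Eq324BenfattoLemma.Site d)} {A : Matrix Λ Λ ℝ} {A' : Matrix Λ' Λ' ℝ} {c : ℝ}

/-- Splitting a sum over `Λ′` into the `Λ`-part (re-indexed by `Λ`) and the collar part. [folklore] -/
private theorem sum_split (hΛ : Λ ⊆ Λ') (g : Λ' → ℝ) :
    ∑ e : Λ', g e = (∑ f : Λ, g ⟨f, hΛ f.2⟩) + ∑ e ∈ (univ : Finset Λ').filter (fun e : Λ' => e.1 ∉ Λ), g e := by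
  classical
  rw [← Finset.sum_filter_add_sum_filter_not (univ : Finset Λ') (fun e : Λ' => e.1 ∈ Λ) g]
  congr 1
  -- the `Λ`-part, re-indexed
  have hmap : (univ : Finset Λ').filter (fun e : Λ' => e.1 ∈ Λ) =
      (univ : Finset Λ).map ⟨fun f : Λ => (⟨(f : B1Eq324BenfattoLemma.Site d), hΛ f.2⟩ : Λ'),
        fun f f' h => Subtype.ext (by simpa using congrArg Subtype.val h)⟩ := by
    ext e
    rw [Finset.mem_filter, Finset.mem_map]
    constructor
    · rintro ⟨-, he⟩
      exact ⟨⟨e.1, he⟩, Finset.mem_univ _, Subtype.ext rfl⟩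
    · rintro ⟨f, -, rfl⟩
      exact ⟨Finset.mem_univ _, f.2⟩
  rw [hmap, Finset.sum_map]
  rfl

/-- **The collar member is symmetric** if `A` is. [cite: BenfattoEtAl1978, Appendix C (C.1) p.164 (class form; ours)] -/
theorem symm_collar (hAs : ∀ e e', A e e' = A e' e)
    (hAA : ∀ (e e' : Λ') (he : (e : B1Eq324BenfattoLemma.Site d) ∈ Λ) (he' : (e' : B1Eq324BenfattoLemma.Site d) ∈ Λ), A' e e' = A ⟨e, he⟩ ⟨e', he'⟩)
    (hcross₁ : ∀ e e' : Λ', (e : B1Eq324BenfattoLemma.Site d) ∈ Λ → (e' : B1Eq324BenfattoLemma.Site d) ∉ Λ → A' e e' = 0)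
    (hcross₂ : ∀ e e' : Λ', (e : B1Eq324BenfattoLemma.Site d) ∉ Λ → (e' : B1Eq324BenfattoLemma.Site d) ∈ Λ → A' e e' = 0)
    (hdiag : ∀ e e' : Λ', (e : B1Eq324BenfattoLemma.Site d) ∉ Λ → (e' : B1Eq324BenfattoLemma.Site d) ∉ Λ → A' e e' = if e = e' then c else 0) :
    ∀ e e', A' e e' = A' e' e := by
  intro e e'
  by_cases he : (e : B1Eq324BenfattoLemma.Site d) ∈ Λ <;> by_cases he' : (e' : B1Eq324BenfattoLemma.Site d) ∈ Λ
  · rw [hAA e e' he he', hAA e' e he' he, hAs]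
  · rw [hcross₁ e e' he he', hcross₂ e' e he' he]
  · rw [hcross₂ e e' he he', hcross₁ e' e he' he]
  · rw [hdiag e e' he he', hdiag e' e he' he]
    by_cases h : e = e'
    · subst h; rfl
    · rw [if_neg h, if_neg (Ne.symm h)]

/-- **The collar member is `γ`-coercive** if `A` is and `γ ≤ c`. [cite: BenfattoEtAl1978, Appendix C (C.1) p.164 (class form; ours)] -/
theorem coercive_collar (hΛ : Λ ⊆ Λ') {γ : ℝ} (hγ : ∀ x : Λ → ℝ, γ * ∑ e, x e ^ 2 ≤ ∑ e, ∑ e', A e e' * x e * x e') (hγc : γ ≤ c)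
    (hAA : ∀ (e e' : Λ') (he : (e : B1Eq324BenfattoLemma.Site d) ∈ Λ) (he' : (e' : B1Eq324BenfattoLemma.Site d) ∈ Λ), A' e e' = A ⟨e, he⟩ ⟨e', he'⟩)
    (hcross₁ : ∀ e e' : Λ', (e : B1Eq324BenfattoLemma.Site d) ∈ Λ → (e' : B1Eq324BenfattoLemma.Site d) ∉ Λ → A' e e' = 0)
    (hcross₂ : ∀ e e' : Λ', (e : B1Eq324BenfattoLemma.Site d) ∉ Λ → (e' : B1Eq324BenfattoLemma.Site d) ∈ Λ → A' e e' = 0)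
    (hdiag : ∀ e e' : Λ', (e : B1Eq324BenfattoLemma.Site d) ∉ Λ → (e' : B1Eq324BenfattoLemma.Site d) ∉ Λ → A' e e' = if e = e' then c else 0)
    (x : Λ' → ℝ) : γ * ∑ e, x e ^ 2 ≤ ∑ e, ∑ e', A' e e' * x e * x e' := by
  classical
  -- the quadratic form splits into the `Λ`-block and the diagonal collar
  have hinner : ∀ e : Λ', ∑ e', A' e e' * x e * x e' =
      (∑ f : Λ, A' e ⟨f, hΛ f.2⟩ * x e * x ⟨f, hΛ f.2⟩) +
        ∑ e' ∈ (univ : Finset Λ').filter (fun e : Λ' => e.1 ∉ Λ), A' e e' * x e * x e' :=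
    fun e => sum_split hΛ _
  have hform : ∑ e, ∑ e', A' e e' * x e * x e' =
      (∑ f : Λ, ∑ f' : Λ, A f f' * x ⟨f, hΛ f.2⟩ * x ⟨f', hΛ f'.2⟩) +
        ∑ e ∈ (univ : Finset Λ').filter (fun e : Λ' => e.1 ∉ Λ), c * x e ^ 2 := by
    rw [sum_split hΛ]
    congr 1
    · refine Finset.sum_congr rfl fun f _ => ?_
      rw [hinner]
      have hzero : ∑ e' ∈ (univ : Finset Λ').filter (fun e : Λ' => e.1 ∉ Λ),
          A' ⟨f, hΛ f.2⟩ e' * x ⟨f, hΛ f.2⟩ * x e' = 0 :=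
        Finset.sum_eq_zero fun e' he' => by
          rw [hcross₁ _ e' f.2 (Finset.mem_filter.mp he').2, zero_mul, zero_mul]
      rw [hzero, add_zero]
      exact Finset.sum_congr rfl fun f' _ => by rw [hAA _ _ f.2 f'.2]
    · refine Finset.sum_congr rfl fun e he => ?_
      have heΛ : (e : B1Eq324BenfattoLemma.Site d) ∉ Λ := (Finset.mem_filter.mp he).2
      rw [hinner]
      have hzero : ∑ f : Λ, A' e ⟨f, hΛ f.2⟩ * x e * x ⟨f, hΛ f.2⟩ = 0 :=
        Finset.sum_eq_zero fun f _ => by rw [hcross₂ e _ heΛ f.2, zero_mul, zero_mul]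
      rw [hzero, zero_add]
      rw [Finset.sum_eq_single_of_mem e he (fun e' he' hne => by
        rw [hdiag e e' heΛ (Finset.mem_filter.mp he').2, if_neg (Ne.symm hne), zero_mul, zero_mul])]
      rw [hdiag e e heΛ heΛ, if_pos rfl]
      ring
  have hsq : ∑ e, x e ^ 2 = (∑ f : Λ, x ⟨f, hΛ f.2⟩ ^ 2) +
      ∑ e ∈ (univ : Finset Λ').filter (fun e : Λ' => e.1 ∉ Λ), x e ^ 2 := sum_split hΛ _
  rw [hform, hsq, mul_add]
  refine add_le_add (hγ fun f => x ⟨f, hΛ f.2⟩) ?_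
  rw [Finset.mul_sum]
  exact Finset.sum_le_sum fun e _ => mul_le_mul_of_nonneg_right hγc (sq_nonneg _)

/-- **A weighted absolute row of the collar member**: if the weight vanishes on the diagonal (`w e e = 0`) or is bounded there, the rows of `A′`
are those of `A` on `Λ` and `|c|·w(e,e)` on the collar.  Here: for a weight with `w e e = w₀` on the collar diagonal and the `Λ`-rows of `A` bounded by
`R`, every row of `A′` is `≤ max R (|c|·w₀)`. [cite: BenfattoEtAl1978, Appendix C (C.1) p.164 (class form; ours)] -/
theorem row_collar_le (hΛ : Λ ⊆ Λ') (w : B1Eq324BenfattoLemma.Site d → B1Eq324BenfattoLemma.Site d → ℝ) {R w₀ : ℝ}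
    (hrow : ∀ e : Λ, ∑ e' : Λ, |A e e'| * w e e' ≤ R) (hw₀ : ∀ e : Λ', (e : B1Eq324BenfattoLemma.Site d) ∉ Λ → w e e = w₀)
    (hAA : ∀ (e e' : Λ') (he : (e : B1Eq324BenfattoLemma.Site d) ∈ Λ) (he' : (e' : B1Eq324BenfattoLemma.Site d) ∈ Λ), A' e e' = A ⟨e, he⟩ ⟨e', he'⟩)
    (hcross₁ : ∀ e e' : Λ', (e : B1Eq324BenfattoLemma.Site d) ∈ Λ → (e' : B1Eq324BenfattoLemma.Site d) ∉ Λ → A' e e' = 0)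
    (hcross₂ : ∀ e e' : Λ', (e : B1Eq324BenfattoLemma.Site d) ∉ Λ → (e' : B1Eq324BenfattoLemma.Site d) ∈ Λ → A' e e' = 0)
    (hdiag : ∀ e e' : Λ', (e : B1Eq324BenfattoLemma.Site d) ∉ Λ → (e' : B1Eq324BenfattoLemma.Site d) ∉ Λ → A' e e' = if e = e' then c else 0)
    (e : Λ') : ∑ e' : Λ', |A' e e'| * w e e' ≤ max R (|c| * w₀) := by
  classical
  rw [sum_split hΛ]
  by_cases he : (e : B1Eq324BenfattoLemma.Site d) ∈ Λ
  · have hzero : ∑ e' ∈ (univ : Finset Λ').filter (fun e : Λ' => e.1 ∉ Λ), |A' e e'| * w e e' = 0 :=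
      Finset.sum_eq_zero fun e' he' => by rw [hcross₁ e e' he (Finset.mem_filter.mp he').2, abs_zero, zero_mul]
    rw [hzero, add_zero]
    have h := hrow ⟨e, he⟩
    calc ∑ f : Λ, |A' e ⟨f, hΛ f.2⟩| * w e ((⟨f, hΛ f.2⟩ : Λ') : B1Eq324BenfattoLemma.Site d)
        = ∑ f : Λ, |A ⟨e, he⟩ f| * w ((⟨e, he⟩ : Λ) : B1Eq324BenfattoLemma.Site d) (f : B1Eq324BenfattoLemma.Site d) :=
          Finset.sum_congr rfl fun f _ => by rw [hAA e _ he f.2]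
      _ ≤ R := h
      _ ≤ max R (|c| * w₀) := le_max_left _ _
  · have hzero : ∑ f : Λ, |A' e ⟨f, hΛ f.2⟩| * w e ((⟨f, hΛ f.2⟩ : Λ') : B1Eq324BenfattoLemma.Site d) = 0 :=
      Finset.sum_eq_zero fun f _ => by rw [hcross₂ e _ he f.2, abs_zero, zero_mul]
    rw [hzero, zero_add]
    have hmem : e ∈ (univ : Finset Λ').filter (fun e : Λ' => e.1 ∉ Λ) := Finset.mem_filter.mpr ⟨Finset.mem_univ _, he⟩
    rw [Finset.sum_eq_single_of_mem e hmem (fun e' he' hne => by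
      rw [hdiag e e' he (Finset.mem_filter.mp he').2, if_neg (Ne.symm hne), abs_zero, zero_mul])]
    rw [hdiag e e he he, if_pos rfl, hw₀ e he]
    exact le_max_right _ _

/-- **The inverse of the collar member is block-diagonal**: `A′⁻¹ e e′ = A⁻¹` on `Λ × Λ`, `c⁻¹·δ` on the collar, `0` across (`A` invertible, `c ≠ 0`).
[cite: BenfattoEtAl1978, Appendix C (C.3)–(C.4) p.164 (class form; ours)] -/
theorem inv_collar_apply (hΛ : Λ ⊆ Λ') (hA : IsUnit A.det) (hc : c ≠ 0)
    (hAA : ∀ (e e' : Λ') (he : (e : B1Eq324BenfattoLemma.Site d) ∈ Λ) (he' : (e' : B1Eq324BenfattoLemma.Site d) ∈ Λ), A' e e' = A ⟨e, he⟩ ⟨e', he'⟩)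
    (hcross₁ : ∀ e e' : Λ', (e : B1Eq324BenfattoLemma.Site d) ∈ Λ → (e' : B1Eq324BenfattoLemma.Site d) ∉ Λ → A' e e' = 0)
    (hcross₂ : ∀ e e' : Λ', (e : B1Eq324BenfattoLemma.Site d) ∉ Λ → (e' : B1Eq324BenfattoLemma.Site d) ∈ Λ → A' e e' = 0)
    (hdiag : ∀ e e' : Λ', (e : B1Eq324BenfattoLemma.Site d) ∉ Λ → (e' : B1Eq324BenfattoLemma.Site d) ∉ Λ → A' e e' = if e = e' then c else 0)
    (e e' : Λ') :
    A'⁻¹ e e' = if h : (e : B1Eq324BenfattoLemma.Site d) ∈ Λ ∧ (e' : B1Eq324BenfattoLemma.Site d) ∈ Λ then A⁻¹ ⟨e, h.1⟩ ⟨e', h.2⟩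
      else if e = e' then c⁻¹ else 0 := by
  classical
  -- the candidate inverse
  set B : Matrix Λ' Λ' ℝ := fun e e' => if h : (e : B1Eq324BenfattoLemma.Site d) ∈ Λ ∧ (e' : B1Eq324BenfattoLemma.Site d) ∈ Λ then
      A⁻¹ ⟨e, h.1⟩ ⟨e', h.2⟩ else if e = e' then c⁻¹ else 0 with hB
  suffices hAB : A' * B = 1 by
    rw [Matrix.inv_eq_right_inv hAB]
  ext e e''
  rw [Matrix.mul_apply, sum_split hΛ]
  by_cases he : (e : B1Eq324BenfattoLemma.Site d) ∈ Λ
  · -- row in `Λ`: the collar part of the sum vanishes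
    have hzero : ∑ e' ∈ (univ : Finset Λ').filter (fun e : Λ' => e.1 ∉ Λ), A' e e' * B e' e'' = 0 :=
      Finset.sum_eq_zero fun e' he' => by rw [hcross₁ e e' he (Finset.mem_filter.mp he').2, zero_mul]
    rw [hzero, add_zero]
    by_cases he'' : (e'' : B1Eq324BenfattoLemma.Site d) ∈ Λ
    · have hsum : ∑ f : Λ, A' e ⟨f, hΛ f.2⟩ * B ⟨f, hΛ f.2⟩ e'' = ∑ f : Λ, A ⟨e, he⟩ f * A⁻¹ f ⟨e'', he''⟩ :=
        Finset.sum_congr rfl fun f _ => by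
          rw [hAA e _ he f.2, hB]
          simp only [dif_pos (And.intro f.2 he'')]
      rw [hsum, ← Matrix.mul_apply, Matrix.mul_nonsing_inv A hA, Matrix.one_apply, Matrix.one_apply]
      by_cases hee : e = e''
      · subst hee; simp
      · have : (⟨(e : B1Eq324BenfattoLemma.Site d), he⟩ : Λ) ≠ ⟨e'', he''⟩ := by
          intro h
          have hv := congrArg Subtype.val h
          exact hee (Subtype.ext hv)
        rw [if_neg this, if_neg hee]
    · have hsum : ∑ f : Λ, A' e ⟨f, hΛ f.2⟩ * B ⟨f, hΛ f.2⟩ e'' = 0 :=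
        Finset.sum_eq_zero fun f _ => by
          rw [hB]
          have h1 : ¬((f : B1Eq324BenfattoLemma.Site d) ∈ Λ ∧ (e'' : B1Eq324BenfattoLemma.Site d) ∈ Λ) := fun h => he'' h.2
          have h2 : (⟨(f : B1Eq324BenfattoLemma.Site d), hΛ f.2⟩ : Λ') ≠ e'' := fun h => he'' (h ▸ f.2)
          simp only [dif_neg h1, if_neg h2, mul_zero]
      have hne : e ≠ e'' := fun h => he'' (h ▸ he)
      rw [hsum, Matrix.one_apply, if_neg hne]
  · -- row in the collar: the `Λ`-part vanishes, the collar part is `c · B e e''`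
    have hzero : ∑ f : Λ, A' e ⟨f, hΛ f.2⟩ * B ⟨f, hΛ f.2⟩ e'' = 0 :=
      Finset.sum_eq_zero fun f _ => by rw [hcross₂ e _ he f.2, zero_mul]
    rw [hzero, zero_add]
    have hmem : e ∈ (univ : Finset Λ').filter (fun e : Λ' => e.1 ∉ Λ) := Finset.mem_filter.mpr ⟨Finset.mem_univ _, he⟩
    rw [Finset.sum_eq_single_of_mem e hmem (fun e' he' hne => by
      rw [hdiag e e' he (Finset.mem_filter.mp he').2, if_neg (Ne.symm hne), zero_mul])]
    rw [hdiag e e he he, if_pos rfl, hB]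
    have h1 : ¬((e : B1Eq324BenfattoLemma.Site d) ∈ Λ ∧ (e'' : B1Eq324BenfattoLemma.Site d) ∈ Λ) := fun h => he h.1
    simp only [dif_neg h1]
    rw [Matrix.one_apply]
    by_cases hee : e = e''
    · rw [if_pos hee, if_pos hee, mul_inv_cancel₀ hc]
    · rw [if_neg hee, if_neg hee, mul_zero]

/-- **The collar member's zero-extended covariance is `K + c⁻¹·1_{Λ′∖Λ}`**: with `K` the zero-extension of `A⁻¹` from `Λ` and `K′` that of `A′⁻¹` from
`Λ′`, `K′ x y = K x y + K_P x y`, `K_P x y = c⁻¹·[x = y ∈ Λ′ ∖ Λ]` — the kernel-level shape of §§3–5. [cite: BenfattoEtAl1978, Appendix C (C.3)–(C.4) p.164 (class form; ours)] -/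
theorem kernel_collar_eq_add (hΛ : Λ ⊆ Λ') (hA : IsUnit A.det) (hc : c ≠ 0)
    (hAA : ∀ (e e' : Λ') (he : (e : B1Eq324BenfattoLemma.Site d) ∈ Λ) (he' : (e' : B1Eq324BenfattoLemma.Site d) ∈ Λ), A' e e' = A ⟨e, he⟩ ⟨e', he'⟩)
    (hcross₁ : ∀ e e' : Λ', (e : B1Eq324BenfattoLemma.Site d) ∈ Λ → (e' : B1Eq324BenfattoLemma.Site d) ∉ Λ → A' e e' = 0)
    (hcross₂ : ∀ e e' : Λ', (e : B1Eq324BenfattoLemma.Site d) ∉ Λ → (e' : B1Eq324BenfattoLemma.Site d) ∈ Λ → A' e e' = 0)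
    (hdiag : ∀ e e' : Λ', (e : B1Eq324BenfattoLemma.Site d) ∉ Λ → (e' : B1Eq324BenfattoLemma.Site d) ∉ Λ → A' e e' = if e = e' then c else 0)
    {K K' : B1Eq324BenfattoLemma.Site d → B1Eq324BenfattoLemma.Site d → ℝ}
    (hK : ∀ x y, K x y = if h : x ∈ Λ ∧ y ∈ Λ then (A⁻¹ : Matrix Λ Λ ℝ) ⟨x, h.1⟩ ⟨y, h.2⟩ else 0)
    (hK' : ∀ x y, K' x y = if h : x ∈ Λ' ∧ y ∈ Λ' then (A'⁻¹ : Matrix Λ' Λ' ℝ) ⟨x, h.1⟩ ⟨y, h.2⟩ else 0) (x y : B1Eq324BenfattoLemma.Site d) :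
    K' x y = K x y + (if x = y ∧ x ∈ Λ' ∧ x ∉ Λ then c⁻¹ else 0) := by
  classical
  rw [hK', hK]
  by_cases hx' : x ∈ Λ' <;> by_cases hy' : y ∈ Λ'
  · rw [dif_pos ⟨hx', hy'⟩, inv_collar_apply hΛ hA hc hAA hcross₁ hcross₂ hdiag]
    by_cases hxy : x ∈ Λ ∧ y ∈ Λ
    · have h' : ((⟨x, hx'⟩ : Λ') : B1Eq324BenfattoLemma.Site d) ∈ Λ ∧ ((⟨y, hy'⟩ : Λ') : B1Eq324BenfattoLemma.Site d) ∈ Λ := hxy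
      rw [dif_pos h', dif_pos hxy]
      have : ¬(x = y ∧ x ∈ Λ' ∧ x ∉ Λ) := fun h => h.2.2 hxy.1
      rw [if_neg this, add_zero]
    · have h' : ¬(((⟨x, hx'⟩ : Λ') : B1Eq324BenfattoLemma.Site d) ∈ Λ ∧ ((⟨y, hy'⟩ : Λ') : B1Eq324BenfattoLemma.Site d) ∈ Λ) := hxy
      rw [dif_neg h', dif_neg hxy, zero_add]
      by_cases hxy' : x = y
      · subst hxy'
        have hxΛ : x ∉ Λ := fun h => hxy ⟨h, h⟩
        rw [if_pos rfl, if_pos ⟨rfl, hx', hxΛ⟩]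
      · have : (⟨x, hx'⟩ : Λ') ≠ ⟨y, hy'⟩ := fun h => hxy' (congrArg Subtype.val h)
        rw [if_neg this, if_neg (fun h => hxy' h.1)]
  · have h1 : ¬(x ∈ Λ' ∧ y ∈ Λ') := fun h => hy' h.2
    have h2 : ¬(x ∈ Λ ∧ y ∈ Λ) := fun h => hy' (hΛ h.2)
    have h3 : ¬(x = y ∧ x ∈ Λ' ∧ x ∉ Λ) := fun h => hy' (h.1 ▸ h.2.1)
    rw [dif_neg h1, dif_neg h2, if_neg h3, add_zero]
  · have h1 : ¬(x ∈ Λ' ∧ y ∈ Λ') := fun h => hx' h.1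
    have h2 : ¬(x ∈ Λ ∧ y ∈ Λ) := fun h => hx' (hΛ h.1)
    have h3 : ¬(x = y ∧ x ∈ Λ' ∧ x ∉ Λ) := fun h => hx' h.2.1
    rw [dif_neg h1, dif_neg h2, if_neg h3, add_zero]
  · have h1 : ¬(x ∈ Λ' ∧ y ∈ Λ') := fun h => hx' h.1
    have h2 : ¬(x ∈ Λ ∧ y ∈ Λ) := fun h => hx' (hΛ h.1)
    have h3 : ¬(x = y ∧ x ∈ Λ' ∧ x ∉ Λ) := fun h => hx' h.2.1
    rw [dif_neg h1, dif_neg h2, if_neg h3, add_zero]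

end Block

/-! ## §2  Two kernels with the same window law integrate every window observable equally -/

section Marginal

variable {K₁ K₂ : B1Eq324BenfattoLemma.Site d → B1Eq324BenfattoLemma.Site d → ℝ}

/-- **Equal Gram blocks on a window ⇒ equal integrals of every observable of that window**: for positive semidefinite kernels with
`covGram K₁ S = covGram K₂ S`, `∫ f(z|_S) d𝒩(0,K₁) = ∫ f(z|_S) d𝒩(0,K₂)` (both are `∫ f dN(0, K_SS)`, `…KernelComparison.integral_comp_restrict_eq`).
[cite: BenfattoEtAl1978, §1 p.144 «a family of gaussian random variables indexed by the tesserae» (class form; ours)] -/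
theorem integral_comp_restrict_eq_of_covGram_eq (h₁ : IsPosSemidefKernel K₁) (h₂ : IsPosSemidefKernel K₂) (S : Finset (B1Eq324BenfattoLemma.Site d))
    (hS : covGram K₁ S = covGram K₂ S) {f : (S → ℝ) → ℝ} (hf : Measurable f) :
    ∫ z, f (S.restrict z) ∂gaussianFieldOfKernel K₁ = ∫ z, f (S.restrict z) ∂gaussianFieldOfKernel K₂ := by
  rw [integral_comp_restrict_eq h₁ S hf, integral_comp_restrict_eq h₂ S hf, hS]

end Marginal

/-! ## §3  The collar at kernel level: `K′ = K + K_P`, `K` living on `Λ`, `K_P` on `P`, `Λ ∩ P = ∅` -/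

section KernelCollar

variable {K K' KP : B1Eq324BenfattoLemma.Site d → B1Eq324BenfattoLemma.Site d → ℝ} {Λ P : Finset (B1Eq324BenfattoLemma.Site d)}

/-- The collar does not touch the `Λ`-window: `covGram K′ Λ = covGram K Λ`. [folklore] [cite: BenfattoEtAl1978, Appendix C (C.1) p.164 (class form; ours)] -/
theorem covGram_collar_eq (hdisj : Disjoint Λ P) (hsum : ∀ x y, K' x y = K x y + KP x y) (hKP0 : ∀ x y, (x ∉ P ∨ y ∉ P) → KP x y = 0) :
    covGram K' Λ = covGram K Λ := by
  ext s t
  rw [covGram_apply, covGram_apply, hsum, hKP0 s t (Or.inl (Finset.disjoint_left.mp hdisj s.2)), add_zero]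

/-- On the collar window the kernel IS the collar kernel: `covGram K′ P = covGram K_P P`. [folklore]
[cite: BenfattoEtAl1978, Appendix C (C.1) p.164 (class form; ours)] -/
theorem covGram_collar_eq_right (hdisj : Disjoint Λ P) (hsum : ∀ x y, K' x y = K x y + KP x y) (hK0 : ∀ x y, (x ∉ Λ ∨ y ∉ Λ) → K x y = 0) :
    covGram K' P = covGram KP P := by
  ext s t
  rw [covGram_apply, covGram_apply, hsum, hK0 s t (Or.inl (Finset.disjoint_right.mp hdisj s.2)), zero_add]

/-- `K′` vanishes across `Λ` and `P`. [folklore] [cite: BenfattoEtAl1978, Appendix C (C.1) p.164 (class form; ours)] -/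
theorem collar_cross_eq_zero (hdisj : Disjoint Λ P) (hsum : ∀ x y, K' x y = K x y + KP x y) (hK0 : ∀ x y, (x ∉ Λ ∨ y ∉ Λ) → K x y = 0)
    (hKP0 : ∀ x y, (x ∉ P ∨ y ∉ P) → KP x y = 0) {x y : B1Eq324BenfattoLemma.Site d} (hx : x ∈ Λ) (hy : y ∈ P) : K' x y = 0 := by
  rw [hsum, hK0 x y (Or.inr (Finset.disjoint_right.mp hdisj hy)), hKP0 x y (Or.inl (Finset.disjoint_left.mp hdisj hx)), add_zero]

/-- The diagonal of `K′` vanishes off `Λ ∪ P`. [folklore] [cite: BenfattoEtAl1978, Appendix C (C.1) p.164 (class form; ours)] -/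
theorem collar_diag_eq_zero (hsum : ∀ x y, K' x y = K x y + KP x y) (hK0 : ∀ x y, (x ∉ Λ ∨ y ∉ Λ) → K x y = 0)
    (hKP0 : ∀ x y, (x ∉ P ∨ y ∉ P) → KP x y = 0) {x : B1Eq324BenfattoLemma.Site d} (hxΛ : x ∉ Λ) (hxP : x ∉ P) : K' x x = 0 := by
  rw [hsum, hK0 x x (Or.inl hxΛ), hKP0 x x (Or.inl hxP), add_zero]

/-- **`H_J` READ THROUGH THE `Λ`-WINDOW**: for `J ⊆ Λ`, `H_J(z) = H_J(ext(z|_Λ))` with `ext w` the extension of `w : Λ → ℝ` by `0`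
(`hamiltonian_congr_eqOn`). [cite: BenfattoEtAl1978, (4.5) p.152] -/
theorem hamiltonian_eq_comp_restrict {s D : ℕ} {ϰ : ℝ} (a : Coef d) {J : Finset (B1Eq324BenfattoLemma.Site d)} (hJ : J ⊆ Λ)
    (z : B1Eq324BenfattoLemma.Site d → ℝ) :
    hamiltonian s D ϰ a J z =
      hamiltonian s D ϰ a J (fun x => if h : x ∈ Λ then Λ.restrict z ⟨x, h⟩ else 0) := by
  refine hamiltonian_congr_eqOn J fun x hx => ?_
  rw [dif_pos (hJ hx)]
  rfl

/-- The extension-by-zero of a window configuration is measurable. [folklore] -/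
private theorem measurable_ext (Λ : Finset (B1Eq324BenfattoLemma.Site d)) :
    Measurable fun (w : Λ → ℝ) (x : B1Eq324BenfattoLemma.Site d) => if h : x ∈ Λ then w ⟨x, h⟩ else 0 := by
  refine measurable_pi_lambda _ fun x => ?_
  by_cases h : x ∈ Λ
  · simp only [dif_pos h]
    exact measurable_pi_apply _
  · simp only [dif_neg h]
    exact measurable_const

/-- **THE CUMULANTS DO NOT SEE THE COLLAR**: for `J ⊆ Λ`, every truncated expectation of `H_J` is the same under `𝒩(0,K′)` and `𝒩(0,K)`
(the moments of `H_J` are window observables of `Λ`, and the two fields have the same `Λ`-window law).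
[cite: BenfattoEtAl1978, (2.7) p.147, (4.5) p.152 (class form; ours)] -/
theorem truncatedExp_collar_eq (hK : IsPosSemidefKernel K) (hK' : IsPosSemidefKernel K') (hΛ : covGram K' Λ = covGram K Λ)
    {s D : ℕ} {ϰ : ℝ} (a : Coef d) {J : Finset (B1Eq324BenfattoLemma.Site d)} (hJ : J ⊆ Λ) (k : ℕ) :
    truncatedExp (gaussianFieldOfKernel K') (hamiltonian s D ϰ a J) k = truncatedExp (gaussianFieldOfKernel K) (hamiltonian s D ϰ a J) k := by
  unfold truncatedExp
  congr 1
  funext n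
  have hmeas : Measurable fun w : Λ → ℝ =>
      hamiltonian s D ϰ a J (fun x => if h : x ∈ Λ then w ⟨x, h⟩ else 0) ^ n :=
    ((measurable_hamiltonian J).comp (measurable_ext Λ)).pow_const n
  have h1 := integral_comp_restrict_eq_of_covGram_eq hK' hK Λ hΛ hmeas
  have hrew : ∀ z : B1Eq324BenfattoLemma.Site d → ℝ, hamiltonian s D ϰ a J z ^ n =
      (fun w : Λ → ℝ => hamiltonian s D ϰ a J (fun x => if h : x ∈ Λ then w ⟨x, h⟩ else 0) ^ n) (Λ.restrict z) :=
    fun z => by rw [hamiltonian_eq_comp_restrict a hJ z]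
  calc ∫ z, hamiltonian s D ϰ a J z ^ n ∂gaussianFieldOfKernel K'
      = ∫ z, (fun w : Λ → ℝ => hamiltonian s D ϰ a J (fun x => if h : x ∈ Λ then w ⟨x, h⟩ else 0) ^ n) (Λ.restrict z)
          ∂gaussianFieldOfKernel K' := integral_congr_ae (Filter.Eventually.of_forall hrew)
    _ = ∫ z, (fun w : Λ → ℝ => hamiltonian s D ϰ a J (fun x => if h : x ∈ Λ then w ⟨x, h⟩ else 0) ^ n) (Λ.restrict z)
          ∂gaussianFieldOfKernel K := h1
    _ = ∫ z, hamiltonian s D ϰ a J z ^ n ∂gaussianFieldOfKernel K := integral_congr_ae (Filter.Eventually.of_forall fun z => (hrew z).symm)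

/-- **The perturbative sum does not see the collar**: `cumulantSum μ_{K′} H_J t = cumulantSum μ_K H_J t` for `J ⊆ Λ`.
[cite: BenfattoEtAl1978, (4.6)–(4.7) p.152 (class form; ours)] -/
theorem cumulantSum_collar_eq (hK : IsPosSemidefKernel K) (hK' : IsPosSemidefKernel K') (hΛ : covGram K' Λ = covGram K Λ)
    {s D : ℕ} {ϰ : ℝ} (a : Coef d) {J : Finset (B1Eq324BenfattoLemma.Site d)} (hJ : J ⊆ Λ) (t : ℕ) :
    cumulantSum (gaussianFieldOfKernel K') (hamiltonian s D ϰ a J) t = cumulantSum (gaussianFieldOfKernel K) (hamiltonian s D ϰ a J) t := by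
  unfold cumulantSum
  exact Finset.sum_congr rfl fun k _ => by rw [truncatedExp_collar_eq hK hK' hΛ a hJ k]


/-! ## §4  The cut-off exponential moment FACTORISES across the collar -/

/-- Window boxes: the small-field constraints of `Π_Δχ̂^I_b` at the sites of a finite window `S`, read on `S → ℝ`. Pointwise: a configuration
vanishing off `Λ ∪ P` is small everywhere iff it is small on `Λ` and on `P` (`b ≥ 0`). [cite: BenfattoEtAl1978, Appendix A (A.1) p.161 (the event)] -/
theorem mem_smallFieldSet_iff_of_vanish (hdisj : Disjoint Λ P) {I : Finset (B1Eq324BenfattoLemma.Site d)} {b : ℝ} (hb : 0 ≤ b)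
    {z : B1Eq324BenfattoLemma.Site d → ℝ} (hz : ∀ x, x ∉ Λ → x ∉ P → z x = 0) :
    z ∈ smallFieldSet I b ↔
      (Λ.restrict z ∈ {w : Λ → ℝ | ∀ f : Λ, |w f| ≤ b * (1 + distToRegion I f)} ∧
        P.restrict z ∈ {v : P → ℝ | ∀ f : P, |v f| ≤ b * (1 + distToRegion I f)}) := by
  have _ := hdisj
  constructor
  · intro h
    exact ⟨fun f => h f, fun f => h f⟩
  · rintro ⟨hΛ, hP⟩ x
    by_cases hxΛ : x ∈ Λ
    · exact hΛ ⟨x, hxΛ⟩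
    · by_cases hxP : x ∈ P
      · exact hP ⟨x, hxP⟩
      · rw [hz x hxΛ hxP, abs_zero]
        exact mul_nonneg hb (by linarith [distToRegion_nonneg I x])

/-- The window box is a measurable set (finitely many closed coordinate constraints). [folklore] -/
private theorem measurableSet_windowBox (S I : Finset (B1Eq324BenfattoLemma.Site d)) (b : ℝ) :
    MeasurableSet {w : S → ℝ | ∀ f : S, |w f| ≤ b * (1 + distToRegion I f)} := by
  have h : {w : S → ℝ | ∀ f : S, |w f| ≤ b * (1 + distToRegion I f)} = ⋂ f : S, {w : S → ℝ | |w f| ≤ b * (1 + distToRegion I f)} := by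
    ext w; simp
  rw [h]
  exact MeasurableSet.iInter fun f => measurableSet_le (measurable_pi_apply f).abs measurable_const

/-- **POINTWISE FACTORISATION**: for a configuration vanishing off `Λ ∪ P` and `J ⊆ Λ`,
`Π_Δχ̂^I_b(z) e^{H_J(z)} = [1_{box_Λ}(z|_Λ) e^{H_J(ext z|_Λ)}] · 1_{box_P}(z|_P)`. [cite: BenfattoEtAl1978, (4.6)–(4.7) p.152, (A.1) p.161 (class form; ours)] -/
theorem cutoffBoltzmann_eq_mul_of_vanish (hdisj : Disjoint Λ P) {s D : ℕ} {ϰ : ℝ} (a : Coef d) {I J : Finset (B1Eq324BenfattoLemma.Site d)}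
    (hJ : J ⊆ Λ) {b : ℝ} (hb : 0 ≤ b) {z : B1Eq324BenfattoLemma.Site d → ℝ} (hz : ∀ x, x ∉ Λ → x ∉ P → z x = 0) :
    cutoffBoltzmann (hamiltonian s D ϰ a J) I b z =
      ({w : Λ → ℝ | ∀ f : Λ, |w f| ≤ b * (1 + distToRegion I f)}.indicator (fun _ => (1 : ℝ)) (Λ.restrict z) *
          Real.exp (hamiltonian s D ϰ a J (fun x => if h : x ∈ Λ then Λ.restrict z ⟨x, h⟩ else 0))) *
        {v : P → ℝ | ∀ f : P, |v f| ≤ b * (1 + distToRegion I f)}.indicator (fun _ => (1 : ℝ)) (P.restrict z) := by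
  classical
  have hiff := mem_smallFieldSet_iff_of_vanish hdisj (I := I) hb hz
  rw [cutoffBoltzmann, ← hamiltonian_eq_comp_restrict a hJ z]
  by_cases hmem : z ∈ smallFieldSet I b
  · obtain ⟨h1, h2⟩ := hiff.mp hmem
    rw [Set.indicator_of_mem hmem, Set.indicator_of_mem h1, Set.indicator_of_mem h2, one_mul, mul_one]
  · rw [Set.indicator_of_notMem hmem]
    by_cases h1 : Λ.restrict z ∈ {w : Λ → ℝ | ∀ f : Λ, |w f| ≤ b * (1 + distToRegion I f)}
    · have h2 : P.restrict z ∉ {v : P → ℝ | ∀ f : P, |v f| ≤ b * (1 + distToRegion I f)} := fun h2 => hmem (hiff.mpr ⟨h1, h2⟩)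
      rw [Set.indicator_of_notMem h2, mul_zero]
    · rw [Set.indicator_of_notMem h1, zero_mul, zero_mul]

/-- **THE CUT-OFF EXPONENTIAL MOMENT FACTORISES ACROSS THE COLLAR**: for `J ⊆ Λ`, `b ≥ 0`,
`∫Π_Δχ̂^I_b e^{H_J} d𝒩(0,K′) = (∫Π_Δχ̂^I_b e^{H_J} d𝒩(0,K)) · 𝒩(0,K_P)(Π_Δχ̂^I_b)` — the fields on `Λ` and on the collar `P` are INDEPENDENT under
`𝒩(0,K′)` (`K′` vanishes across: `…KernelComparison.integral_prod_eq_prod_integral_shift`), the `Λ`-window law of `𝒩(0,K′)` is that of `𝒩(0,K)` and its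
`P`-window law that of `𝒩(0,K_P)`, and all three fields vanish a.s. off their supports (`…KernelSect5Eq513.ae_forall_eval_eq_zero`).
[cite: BenfattoEtAl1978, (4.6)–(4.7) p.152, §5 (5.13) p.155 (independence across decoupled regions; class form; ours)] -/
theorem integral_cutoffBoltzmann_collar_eq_mul (hK : IsPosSemidefKernel K) (hK' : IsPosSemidefKernel K') (hKP : IsPosSemidefKernel KP)
    (hdisj : Disjoint Λ P) (hsum : ∀ x y, K' x y = K x y + KP x y) (hK0 : ∀ x y, (x ∉ Λ ∨ y ∉ Λ) → K x y = 0)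
    (hKP0 : ∀ x y, (x ∉ P ∨ y ∉ P) → KP x y = 0)
    {s D : ℕ} {ϰ : ℝ} (a : Coef d) {I J : Finset (B1Eq324BenfattoLemma.Site d)} (hJ : J ⊆ Λ) {b : ℝ} (hb : 0 ≤ b) :
    ∫ z, cutoffBoltzmann (hamiltonian s D ϰ a J) I b z ∂gaussianFieldOfKernel K' =
      (∫ z, cutoffBoltzmann (hamiltonian s D ϰ a J) I b z ∂gaussianFieldOfKernel K) *
        (gaussianFieldOfKernel KP).real (smallFieldSet I b) := by
  classical
  -- the two window observables
  set f₁ : (Λ → ℝ) → ℝ := fun w =>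
    {w' : Λ → ℝ | ∀ f : Λ, |w' f| ≤ b * (1 + distToRegion I f)}.indicator (fun _ => (1 : ℝ)) w *
      Real.exp (hamiltonian s D ϰ a J (fun x => if h : x ∈ Λ then w ⟨x, h⟩ else 0)) with hf₁
  set f₂ : (P → ℝ) → ℝ := fun v =>
    {v' : P → ℝ | ∀ f : P, |v' f| ≤ b * (1 + distToRegion I f)}.indicator (fun _ => (1 : ℝ)) v with hf₂
  have hf₁m : Measurable f₁ :=
    (measurable_const.indicator (measurableSet_windowBox Λ I b)).mul ((measurable_hamiltonian J).comp (measurable_ext Λ)).exp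
  have hf₂m : Measurable f₂ := measurable_const.indicator (measurableSet_windowBox P I b)
  -- indexed by `Bool` for the product lemma (true ↦ Λ, false ↦ P)
  let F : (i : Bool) → (((↑(bif i then Λ else P) : Set (B1Eq324BenfattoLemma.Site d))) → ℝ) → ℝ := fun i =>
    match i with
    | true => fun w => f₁ fun f : Λ => w ⟨f, f.2⟩
    | false => fun w => f₂ fun f : P => w ⟨f, f.2⟩
  have hFt : ∀ z : B1Eq324BenfattoLemma.Site d → ℝ,
      F true (fun x : ((↑(bif true then Λ else P) : Set (B1Eq324BenfattoLemma.Site d))) => z x) = f₁ (Λ.restrict z) := fun z => rfl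
  have hFf : ∀ z : B1Eq324BenfattoLemma.Site d → ℝ,
      F false (fun x : ((↑(bif false then Λ else P) : Set (B1Eq324BenfattoLemma.Site d))) => z x) = f₂ (P.restrict z) := fun z => rfl
  have hFm : ∀ i, Measurable (F i) := by
    intro i
    cases i with
    | true => exact hf₁m.comp (measurable_pi_lambda _ fun f => measurable_pi_apply _)
    | false => exact hf₂m.comp (measurable_pi_lambda _ fun f => measurable_pi_apply _)
  -- `K′` vanishes across the two windows
  have hvan : ∀ i j, i ≠ j → ∀ x ∈ ((↑(bif i then Λ else P) : Set (B1Eq324BenfattoLemma.Site d))),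
      ∀ y ∈ ((↑(bif j then Λ else P) : Set (B1Eq324BenfattoLemma.Site d))), K' x y = 0 := by
    intro i j hij x hx y hy
    cases i <;> cases j
    · exact absurd rfl hij
    · -- x ∈ P, y ∈ Λ
      rw [hsum, hK0 x y (Or.inl (Finset.disjoint_right.mp hdisj (Finset.mem_coe.mp hx))),
        hKP0 x y (Or.inr (Finset.disjoint_left.mp hdisj (Finset.mem_coe.mp hy))), add_zero]
    · exact collar_cross_eq_zero hdisj hsum hK0 hKP0 (Finset.mem_coe.mp hx) (Finset.mem_coe.mp hy)
    · exact absurd rfl hij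
  -- the unshifted field is the shifted field with `u = 0`
  have hshift : ((gaussianFieldOfKernel K').map fun (ζ : B1Eq324BenfattoLemma.Site d → ℝ) (x : B1Eq324BenfattoLemma.Site d) =>
      (0 : B1Eq324BenfattoLemma.Site d → ℝ) x + ζ x) = gaussianFieldOfKernel K' := by
    have : (fun (ζ : B1Eq324BenfattoLemma.Site d → ℝ) (x : B1Eq324BenfattoLemma.Site d) => (0 : B1Eq324BenfattoLemma.Site d → ℝ) x + ζ x) = id := by
      funext ζ x; simp
    rw [this, Measure.map_id]
  have hprod := integral_prod_eq_prod_integral_shift hK' hvan 0 F hFm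
  rw [hshift] at hprod
  simp only [Fintype.prod_bool, hFt, hFf] at hprod
  -- a.s. under `𝒩(0,K′)` the integrand IS `f₁(z|_Λ) · f₂(z|_P)`
  have hptw : ∀ z : B1Eq324BenfattoLemma.Site d → ℝ, (∀ x ∈ {x : B1Eq324BenfattoLemma.Site d | x ∉ Λ ∧ x ∉ P}, z x = 0) →
      cutoffBoltzmann (hamiltonian s D ϰ a J) I b z = f₁ (Λ.restrict z) * f₂ (P.restrict z) := by
    intro z hz
    rw [cutoffBoltzmann_eq_mul_of_vanish hdisj a hJ hb (fun x h1 h2 => hz x ⟨h1, h2⟩)]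
  have hL : ∫ z, cutoffBoltzmann (hamiltonian s D ϰ a J) I b z ∂gaussianFieldOfKernel K' =
      ∫ z, f₁ (Λ.restrict z) * f₂ (P.restrict z) ∂gaussianFieldOfKernel K' := by
    refine integral_congr_ae ?_
    filter_upwards [ae_forall_eval_eq_zero hK' (S := {x : B1Eq324BenfattoLemma.Site d | x ∉ Λ ∧ x ∉ P})
      fun x hx => collar_diag_eq_zero hsum hK0 hKP0 hx.1 hx.2] with z hz
    exact hptw z hz
  rw [hL, hprod]
  -- the `Λ`-factor
  have hΛfac : ∫ z, f₁ (Λ.restrict z) ∂gaussianFieldOfKernel K' = ∫ z, cutoffBoltzmann (hamiltonian s D ϰ a J) I b z ∂gaussianFieldOfKernel K := by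
    rw [integral_comp_restrict_eq_of_covGram_eq hK' hK Λ (covGram_collar_eq hdisj hsum hKP0) hf₁m]
    refine integral_congr_ae ?_
    filter_upwards [ae_forall_eval_eq_zero hK (S := {x : B1Eq324BenfattoLemma.Site d | x ∉ Λ}) fun x hx => hK0 x x (Or.inl hx)] with z hz
    rw [hptw z fun x hx => hz x hx.1]
    -- on such `z` the collar window reads `0`, inside its box
    have hmem : P.restrict z ∈ {v' : P → ℝ | ∀ f : P, |v' f| ≤ b * (1 + distToRegion I f)} := by
      intro f
      show |z f| ≤ _
      rw [hz f (Finset.disjoint_right.mp hdisj f.2), abs_zero]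
      exact mul_nonneg hb (by linarith [distToRegion_nonneg I f])
    rw [hf₂]
    dsimp only
    rw [Set.indicator_of_mem hmem, mul_one]
  -- the `P`-factor
  have hPfac : ∫ z, f₂ (P.restrict z) ∂gaussianFieldOfKernel K' = (gaussianFieldOfKernel KP).real (smallFieldSet I b) := by
    rw [integral_comp_restrict_eq_of_covGram_eq hK' hKP P (covGram_collar_eq_right hdisj hsum hK0) hf₂m,
      ← integral_cutoffBoltzmann_empty_measure (gaussianFieldOfKernel KP) a I b (s := s) (D := D) (κ := ϰ)]
    refine integral_congr_ae ?_
    filter_upwards [ae_forall_eval_eq_zero hKP (S := {x : B1Eq324BenfattoLemma.Site d | x ∉ P}) fun x hx => hKP0 x x (Or.inl hx)] with z hz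
    have hz' : ∀ x, x ∉ Λ → x ∉ P → z x = 0 := fun x _ h2 => hz x h2
    have hiff := mem_smallFieldSet_iff_of_vanish hdisj (I := I) hb hz'
    have hΛbox : Λ.restrict z ∈ {w : Λ → ℝ | ∀ f : Λ, |w f| ≤ b * (1 + distToRegion I f)} := by
      intro f
      show |z f| ≤ _
      rw [hz f (Finset.disjoint_left.mp hdisj f.2), abs_zero]
      exact mul_nonneg hb (by linarith [distToRegion_nonneg I f])
    rw [cutoffBoltzmann, hf₂]
    dsimp only
    by_cases hmem : z ∈ smallFieldSet I b
    · rw [Set.indicator_of_mem hmem, Set.indicator_of_mem (hiff.mp hmem).2, hamiltonian_empty, Real.exp_zero]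
    · have h2 : P.restrict z ∉ {v : P → ℝ | ∀ f : P, |v f| ≤ b * (1 + distToRegion I f)} := fun h2 => hmem (hiff.mpr ⟨hΛbox, h2⟩)
      rw [Set.indicator_of_notMem hmem, Set.indicator_of_notMem h2]
  rw [hΛfac, hPfac]


/-! ## §5  The collar's own small-field volume, and THE TRANSFER of the two-sided sandwich -/

/-- The collar's small-field volume is at most `1`. [cite: BenfattoEtAl1978, Appendix A (A.1) p.161 (class form; ours)] -/
theorem collarVolume_le_one (hKP : IsPosSemidefKernel KP) (I : Finset (B1Eq324BenfattoLemma.Site d)) (b : ℝ) :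
    (gaussianFieldOfKernel KP).real (smallFieldSet I b) ≤ 1 := by
  haveI := isProbabilityMeasure_gaussianFieldOfKernel hKP
  exact measureReal_le_one

/-- **The collar's small-field volume is `≥ exp(−|I|·4·8^d·e^{−b²/(2C)})`** for a collar kernel with diagonal `≤ C` and `b² ≥ 4C` — seat n08-w5's class
Appendix A (`…KernelSect5Termination.integral_cutoffBoltzmann_empty_ge_of_kernel_translate`) for the collar member ALONE; note the factor `|I|`, not `|P|`.
[cite: BenfattoEtAl1978, Appendix A (A.1)–(A.2) p.161 (class form; ours)] -/
theorem exp_neg_le_collarVolume (hKP : IsPosSemidefKernel KP) {C : ℝ} (hC : 0 < C) (hKPC : ∀ x, KP x x ≤ C) {b : ℝ} (hb : 0 < b)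
    (hbC : 4 * C ≤ b ^ 2) {I : Finset (B1Eq324BenfattoLemma.Site d)} (hI : I.Nonempty) :
    Real.exp (-((I.card : ℝ) * (4 * 8 ^ d * Real.exp (-(b ^ 2 / (2 * C)))))) ≤ (gaussianFieldOfKernel KP).real (smallFieldSet I b) := by
  have h := integral_cutoffBoltzmann_empty_ge_of_kernel_translate (s := 0) (D := 0) (κ := 0) hKP hC hKPC hb hbC
    (fun _ _ _ => (0 : ℝ)) hI 0
  have hK0 : (fun x y : B1Eq324BenfattoLemma.Site d => KP (x + 0) (y + 0)) = KP := by
    funext x y; rw [add_zero, add_zero]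
  rw [hK0, integral_cutoffBoltzmann_empty_measure] at h
  exact h

/-- The collar's volume defect is ABSORBED by print's error term: `4·8^d·e^{−b²/(2C)} ≤ errTerm (4·8^d) ρ₁ ρ₂ ρ₃ ρ₄ A b t` once `ρ₃ b^{3/2} ≤ b²/(2C)`
(`A ≥ 0`, `ρ₄ ≥ 0`, `b ≥ 0`; the second summand of `errTerm` is `≥ e^{−ρ₃ b^{3/2}}`). [cite: BenfattoEtAl1978, (4.6)–(4.7) p.152, Remark 4 p.153 (class form; ours)] -/
theorem collarDefect_le_errTerm {C ρ₁ ρ₂ ρ₃ ρ₄ A b : ℝ} (t : ℕ) (hA : 0 ≤ A) (hρ₄ : 0 ≤ ρ₄) (hb : 0 ≤ b)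
    (hbig : ρ₃ * b ^ (3 / 2 : ℝ) ≤ b ^ 2 / (2 * C)) :
    4 * 8 ^ d * Real.exp (-(b ^ 2 / (2 * C))) ≤ errTerm (4 * 8 ^ d) ρ₁ ρ₂ ρ₃ ρ₄ A b t := by
  unfold errTerm
  have h1 : Real.exp (-(b ^ 2 / (2 * C))) ≤ Real.exp (-(ρ₃ * b ^ (3 / 2 : ℝ))) := Real.exp_le_exp.mpr (by linarith)
  have h2 : 1 ≤ Real.exp (ρ₄ * A * b ^ ρ₃) := Real.one_le_exp (mul_nonneg (mul_nonneg hρ₄ hA) (Real.rpow_nonneg hb _))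
  have h3 : 0 ≤ (A * b ^ ρ₁ * Real.exp (ρ₂ * A * b ^ ρ₃)) ^ (t + 1) :=
    pow_nonneg (mul_nonneg (mul_nonneg hA (Real.rpow_nonneg hb _)) (Real.exp_pos _).le) _
  have h4 : Real.exp (-(b ^ 2 / (2 * C))) ≤ Real.exp (-(ρ₃ * b ^ (3 / 2 : ℝ))) * Real.exp (ρ₄ * A * b ^ ρ₃) := by
    calc Real.exp (-(b ^ 2 / (2 * C))) ≤ Real.exp (-(ρ₃ * b ^ (3 / 2 : ℝ))) * 1 := by rw [mul_one]; exact h1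
      _ ≤ Real.exp (-(ρ₃ * b ^ (3 / 2 : ℝ))) * Real.exp (ρ₄ * A * b ^ ρ₃) := mul_le_mul_of_nonneg_left h2 (Real.exp_pos _).le
  have h8 : (0 : ℝ) ≤ 4 * 8 ^ d := by positivity
  calc 4 * 8 ^ d * Real.exp (-(b ^ 2 / (2 * C)))
      ≤ 4 * 8 ^ d * (Real.exp (-(ρ₃ * b ^ (3 / 2 : ℝ))) * Real.exp (ρ₄ * A * b ^ ρ₃)) := mul_le_mul_of_nonneg_left h4 h8
    _ ≤ 4 * 8 ^ d * ((A * b ^ ρ₁ * Real.exp (ρ₂ * A * b ^ ρ₃)) ^ (t + 1) + Real.exp (-(ρ₃ * b ^ (3 / 2 : ℝ))) * Real.exp (ρ₄ * A * b ^ ρ₃)) := by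
        refine mul_le_mul_of_nonneg_left ?_ h8
        linarith

/-- ★★★ **THE COLLAR TRANSFER.**  Let `K′ = K + K_P` with `K` living on `Λ`, `K_P` on `P`, `Λ ∩ P = ∅` (all positive semidefinite), `K_P`'s diagonal
`≤ C`, and `J ⊆ Λ`, `I ≠ ∅`, `b > 0`, `b² ≥ 4C`.  If the two-sided sandwich holds for `𝒩(0,K′)` at `(s, I, J, a, b, t)` with error `E`:
`exp(Σ′ − E) ≤ ∫Π_Δχ̂^I_b e^{H_J} d𝒩(0,K′) ≤ exp(Σ′ + E)`, `Σ′ = cumulantSum 𝒩(0,K′) H_J t`, then it holds for `𝒩(0,K)` with `Σ = cumulantSum 𝒩(0,K) H_J t (= Σ′)`, the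
SAME lower error and the upper error `E + |I|·4·8^d·e^{−b²/(2C)}` — the interior-pad admissibility of the class Basic Lemma is thus NOT a restriction: pad the
member by an independent collar, apply the lemma there, transfer back.  (`cumulantSum_collar_eq`, `integral_cutoffBoltzmann_collar_eq_mul`,
`collarVolume_le_one`, `exp_neg_le_collarVolume`.)
[cite: BenfattoEtAl1978, Lemma (4.6)–(4.7) p.152 (on `ℤ^d`, no boundary); Appendix A p.161 (class form; the collar is ours)] -/
theorem sandwich_of_collar_sandwich (hK : IsPosSemidefKernel K) (hK' : IsPosSemidefKernel K') (hKP : IsPosSemidefKernel KP)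
    (hdisj : Disjoint Λ P) (hsum : ∀ x y, K' x y = K x y + KP x y) (hK0 : ∀ x y, (x ∉ Λ ∨ y ∉ Λ) → K x y = 0)
    (hKP0 : ∀ x y, (x ∉ P ∨ y ∉ P) → KP x y = 0) {C : ℝ} (hC : 0 < C) (hKPC : ∀ x, KP x x ≤ C)
    {s D : ℕ} {ϰ : ℝ} (a : Coef d) {I J : Finset (B1Eq324BenfattoLemma.Site d)} (hJ : J ⊆ Λ) (hI : I.Nonempty)
    {b : ℝ} (hb : 0 < b) (hbC : 4 * C ≤ b ^ 2) (t : ℕ) {E : ℝ}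
    (hlow : Real.exp (cumulantSum (gaussianFieldOfKernel K') (hamiltonian s D ϰ a J) t - E) ≤
      ∫ z, cutoffBoltzmann (hamiltonian s D ϰ a J) I b z ∂gaussianFieldOfKernel K')
    (hup : ∫ z, cutoffBoltzmann (hamiltonian s D ϰ a J) I b z ∂gaussianFieldOfKernel K' ≤
      Real.exp (cumulantSum (gaussianFieldOfKernel K') (hamiltonian s D ϰ a J) t + E)) :
    Real.exp (cumulantSum (gaussianFieldOfKernel K) (hamiltonian s D ϰ a J) t - E) ≤
        ∫ z, cutoffBoltzmann (hamiltonian s D ϰ a J) I b z ∂gaussianFieldOfKernel K ∧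
      ∫ z, cutoffBoltzmann (hamiltonian s D ϰ a J) I b z ∂gaussianFieldOfKernel K ≤
        Real.exp (cumulantSum (gaussianFieldOfKernel K) (hamiltonian s D ϰ a J) t + E +
          (I.card : ℝ) * (4 * 8 ^ d * Real.exp (-(b ^ 2 / (2 * C))))) := by
  have hcs := cumulantSum_collar_eq hK hK' (covGram_collar_eq hdisj hsum hKP0) a hJ t (s := s) (D := D) (ϰ := ϰ)
  have hfac := integral_cutoffBoltzmann_collar_eq_mul hK hK' hKP hdisj hsum hK0 hKP0 a hJ hb.le (s := s) (D := D) (ϰ := ϰ) (I := I)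
  set Z := ∫ z, cutoffBoltzmann (hamiltonian s D ϰ a J) I b z ∂gaussianFieldOfKernel K with hZ
  set v := (gaussianFieldOfKernel KP).real (smallFieldSet I b) with hv
  have hZ0 : 0 ≤ Z := integral_nonneg fun z => by
    rw [cutoffBoltzmann]
    exact Set.indicator_nonneg (fun _ _ => (Real.exp_pos _).le) _
  have hv1 : v ≤ 1 := collarVolume_le_one hKP I b
  have hvlow := exp_neg_le_collarVolume hKP hC hKPC hb hbC hI (d := d)
  have hv0 : 0 < v := lt_of_lt_of_le (Real.exp_pos _) hvlow
  rw [hcs, hfac] at hlow hup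
  refine ⟨?_, ?_⟩
  · -- lower: `exp(Σ − E) ≤ Z·v ≤ Z`
    calc Real.exp (cumulantSum (gaussianFieldOfKernel K) (hamiltonian s D ϰ a J) t - E) ≤ Z * v := hlow
      _ ≤ Z * 1 := mul_le_mul_of_nonneg_left hv1 hZ0
      _ = Z := mul_one Z
  · -- upper: `Z ≤ exp(Σ + E)/v ≤ exp(Σ + E)·exp(δ)`
    have h1 : Z ≤ Real.exp (cumulantSum (gaussianFieldOfKernel K) (hamiltonian s D ϰ a J) t + E) / v := by
      rw [le_div_iff₀ hv0]; exact hup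
    have h2 : 1 / v ≤ Real.exp ((I.card : ℝ) * (4 * 8 ^ d * Real.exp (-(b ^ 2 / (2 * C))))) := by
      have h := one_div_le_one_div_of_le (Real.exp_pos _) hvlow
      rw [Real.exp_neg, one_div, one_div, inv_inv] at h
      rw [one_div]
      exact h
    calc Z ≤ Real.exp (cumulantSum (gaussianFieldOfKernel K) (hamiltonian s D ϰ a J) t + E) / v := h1
      _ = Real.exp (cumulantSum (gaussianFieldOfKernel K) (hamiltonian s D ϰ a J) t + E) * (1 / v) := by ring
      _ ≤ Real.exp (cumulantSum (gaussianFieldOfKernel K) (hamiltonian s D ϰ a J) t + E) *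
            Real.exp ((I.card : ℝ) * (4 * 8 ^ d * Real.exp (-(b ^ 2 / (2 * C))))) := mul_le_mul_of_nonneg_left h2 (Real.exp_pos _).le
      _ = Real.exp (cumulantSum (gaussianFieldOfKernel K) (hamiltonian s D ϰ a J) t + E +
            (I.card : ℝ) * (4 * 8 ^ d * Real.exp (-(b ^ 2 / (2 * C))))) := by rw [← Real.exp_add]

/-- ★★★ **THE COLLAR TRANSFER IN PRINT's CURRENCY** — the shape `…Eq324Signed.eq324_of_sandwich_consts` eats: if the sandwich holds for `𝒩(0,K′)` with
`E = |I|·errTerm S ρ₁ ρ₂ ρ₃ ρ₄ (coefSup s D a J) b t`, then it holds for `𝒩(0,K)` with `S + 4·8^d` in place of `S`, provided `ρ₃ b^{3/2} ≤ b²/(2C)`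
(i.e. `√b ≥ 2Cρ₃`), `ρ₄ ≥ 0`. [cite: BenfattoEtAl1978, Lemma (4.6)–(4.7) p.152, Remark 4 p.153 (class form; the collar is ours)] -/
theorem sandwich_of_collar_sandwich_errTerm (hK : IsPosSemidefKernel K) (hK' : IsPosSemidefKernel K') (hKP : IsPosSemidefKernel KP)
    (hdisj : Disjoint Λ P) (hsum : ∀ x y, K' x y = K x y + KP x y) (hK0 : ∀ x y, (x ∉ Λ ∨ y ∉ Λ) → K x y = 0)
    (hKP0 : ∀ x y, (x ∉ P ∨ y ∉ P) → KP x y = 0) {C : ℝ} (hC : 0 < C) (hKPC : ∀ x, KP x x ≤ C)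
    {s D : ℕ} {ϰ : ℝ} (a : Coef d) {I J : Finset (B1Eq324BenfattoLemma.Site d)} (hJ : J ⊆ Λ) (hI : I.Nonempty)
    {b : ℝ} (hb : 0 < b) (hbC : 4 * C ≤ b ^ 2) (t : ℕ) {S ρ₁ ρ₂ ρ₃ ρ₄ : ℝ} (hρ₄ : 0 ≤ ρ₄)
    (hbig : ρ₃ * b ^ (3 / 2 : ℝ) ≤ b ^ 2 / (2 * C))
    (hlow : Real.exp (cumulantSum (gaussianFieldOfKernel K') (hamiltonian s D ϰ a J) t -
        (I.card : ℝ) * errTerm S ρ₁ ρ₂ ρ₃ ρ₄ (coefSup s D a J) b t) ≤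
      ∫ z, cutoffBoltzmann (hamiltonian s D ϰ a J) I b z ∂gaussianFieldOfKernel K')
    (hup : ∫ z, cutoffBoltzmann (hamiltonian s D ϰ a J) I b z ∂gaussianFieldOfKernel K' ≤
      Real.exp (cumulantSum (gaussianFieldOfKernel K') (hamiltonian s D ϰ a J) t +
        (I.card : ℝ) * errTerm S ρ₁ ρ₂ ρ₃ ρ₄ (coefSup s D a J) b t)) :
    Real.exp (cumulantSum (gaussianFieldOfKernel K) (hamiltonian s D ϰ a J) t -
          (I.card : ℝ) * errTerm (S + 4 * 8 ^ d) ρ₁ ρ₂ ρ₃ ρ₄ (coefSup s D a J) b t) ≤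
        ∫ z, cutoffBoltzmann (hamiltonian s D ϰ a J) I b z ∂gaussianFieldOfKernel K ∧
      ∫ z, cutoffBoltzmann (hamiltonian s D ϰ a J) I b z ∂gaussianFieldOfKernel K ≤
        Real.exp (cumulantSum (gaussianFieldOfKernel K) (hamiltonian s D ϰ a J) t +
          (I.card : ℝ) * errTerm (S + 4 * 8 ^ d) ρ₁ ρ₂ ρ₃ ρ₄ (coefSup s D a J) b t) := by
  obtain ⟨h1, h2⟩ := sandwich_of_collar_sandwich hK hK' hKP hdisj hsum hK0 hKP0 hC hKPC a hJ hI hb hbC t hlow hup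
  have hA : 0 ≤ coefSup s D a J := B1Eq324BenfattoSpecialisation.coefSup_nonneg s D a J
  have hdef := collarDefect_le_errTerm (d := d) (C := C) (ρ₁ := ρ₁) (ρ₂ := ρ₂) t hA hρ₄ hb.le hbig
  have hI0 : (0 : ℝ) ≤ I.card := Nat.cast_nonneg _
  have hsplit : (I.card : ℝ) * errTerm (S + 4 * 8 ^ d) ρ₁ ρ₂ ρ₃ ρ₄ (coefSup s D a J) b t =
      (I.card : ℝ) * errTerm S ρ₁ ρ₂ ρ₃ ρ₄ (coefSup s D a J) b t + (I.card : ℝ) * errTerm (4 * 8 ^ d) ρ₁ ρ₂ ρ₃ ρ₄ (coefSup s D a J) b t := by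
    rw [errTerm_add]; ring
  have hextra : 0 ≤ (I.card : ℝ) * errTerm (4 * 8 ^ d) ρ₁ ρ₂ ρ₃ ρ₄ (coefSup s D a J) b t :=
    mul_nonneg hI0 (le_trans (by positivity) hdef)
  refine ⟨le_trans (Real.exp_le_exp.mpr ?_) h1, h2.trans (Real.exp_le_exp.mpr ?_)⟩
  · rw [hsplit]; linarith
  · rw [hsplit]
    have := mul_le_mul_of_nonneg_left hdef hI0
    linarith

end KernelCollar

/-! ## §6  THE PACKAGE in the class theorems' letters -/

section Package

variable {Λ Λ' : Finset (B1Eq324BenfattoLemma.Site d)} {A : Matrix Λ Λ ℝ} {A' : Matrix Λ' Λ' ℝ} {c : ℝ}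
  {K K' : B1Eq324BenfattoLemma.Site d → B1Eq324BenfattoLemma.Site d → ℝ}

/-- The collar's diagonal kernel `c⁻¹·1_{x = y ∈ Λ′∖Λ}` is positive semidefinite for `c > 0` (a non-negative diagonal Gram matrix). [folklore]
[cite: BenfattoEtAl1978, Appendix C (C.1) p.164 (class form; ours)] -/
theorem isPosSemidefKernel_collarDiag (hc : 0 < c) :
    IsPosSemidefKernel fun x y : B1Eq324BenfattoLemma.Site d => if x = y ∧ x ∈ Λ' ∧ x ∉ Λ then c⁻¹ else 0 := by
  classical
  intro I
  have hdiag : covGram (fun x y : B1Eq324BenfattoLemma.Site d => if x = y ∧ x ∈ Λ' ∧ x ∉ Λ then c⁻¹ else 0) I =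
      Matrix.diagonal fun s : I => if (s : B1Eq324BenfattoLemma.Site d) ∈ Λ' ∧ (s : B1Eq324BenfattoLemma.Site d) ∉ Λ then c⁻¹ else 0 := by
    ext s t
    rw [covGram_apply, Matrix.diagonal_apply]
    by_cases hst : s = t
    · subst hst
      by_cases h : (s : B1Eq324BenfattoLemma.Site d) ∈ Λ' ∧ (s : B1Eq324BenfattoLemma.Site d) ∉ Λ
      · rw [if_pos ⟨rfl, h⟩, if_pos rfl, if_pos h]
      · rw [if_neg (fun h' => h h'.2), if_pos rfl, if_neg h]
    · have hst' : (s : B1Eq324BenfattoLemma.Site d) ≠ t := fun h => hst (Subtype.ext h)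
      rw [if_neg (fun h => hst' h.1), if_neg hst]
  rw [hdiag]
  refine Matrix.PosSemidef.diagonal fun s => ?_
  show (0 : ℝ) ≤ if (s : B1Eq324BenfattoLemma.Site d) ∈ Λ' ∧ (s : B1Eq324BenfattoLemma.Site d) ∉ Λ then c⁻¹ else 0
  split_ifs
  · exact inv_nonneg.mpr hc.le
  · exact le_rfl

/-- ★★★ **THE COLLAR TRANSFER, PACKAGED.**  Member `(Λ, A)` (`A` positive definite) with zero-extended covariance `K`; collar member `(Λ′, A′)`, `Λ ⊆ Λ′`,
described by the block hypotheses (`A′ = A` on `Λ × Λ`, `0` across, `c·δ` on the collar, `c > 0`; `A′` positive definite — e.g. by `symm_collar` +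
`coercive_collar`) with zero-extended covariance `K′`.  If the two-sided sandwich of print's Lemma holds for `𝒩(0, K′)` at `(s, I, J, a, b, t)` with
constants `(S, ρ₁, ρ₂, ρ₃, ρ₄)` — `J ⊆ Λ`, `I ≠ ∅`, `b > 0`, `b² ≥ 4/c`, `ρ₃ b^{3/2} ≤ c b²/2`, `ρ₄ ≥ 0` — then it holds for `𝒩(0, K)` at the same data with
`S + 4·8^d`.  So the class Basic Lemma's interior pad is met by padding, never by restricting `J`.
[cite: BenfattoEtAl1978, Lemma (4.6)–(4.7) p.152 (on `ℤ^d`); Appendix A p.161; Balaban1985BackgroundPropagators, Sect. E p.428 (class form; the collar is ours)] -/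
theorem sandwich_of_collarMember_sandwich (hΛ : Λ ⊆ Λ') (hc : 0 < c) (hApd : A.PosDef) (hA'pd : A'.PosDef)
    (hAA : ∀ (e e' : Λ') (he : (e : B1Eq324BenfattoLemma.Site d) ∈ Λ) (he' : (e' : B1Eq324BenfattoLemma.Site d) ∈ Λ), A' e e' = A ⟨e, he⟩ ⟨e', he'⟩)
    (hcross₁ : ∀ e e' : Λ', (e : B1Eq324BenfattoLemma.Site d) ∈ Λ → (e' : B1Eq324BenfattoLemma.Site d) ∉ Λ → A' e e' = 0)
    (hcross₂ : ∀ e e' : Λ', (e : B1Eq324BenfattoLemma.Site d) ∉ Λ → (e' : B1Eq324BenfattoLemma.Site d) ∈ Λ → A' e e' = 0)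
    (hdiag : ∀ e e' : Λ', (e : B1Eq324BenfattoLemma.Site d) ∉ Λ → (e' : B1Eq324BenfattoLemma.Site d) ∉ Λ → A' e e' = if e = e' then c else 0)
    (hK : ∀ x y, K x y = if h : x ∈ Λ ∧ y ∈ Λ then (A⁻¹ : Matrix Λ Λ ℝ) ⟨x, h.1⟩ ⟨y, h.2⟩ else 0)
    (hK' : ∀ x y, K' x y = if h : x ∈ Λ' ∧ y ∈ Λ' then (A'⁻¹ : Matrix Λ' Λ' ℝ) ⟨x, h.1⟩ ⟨y, h.2⟩ else 0)
    {s D : ℕ} {ϰ : ℝ} (a : Coef d) {I J : Finset (B1Eq324BenfattoLemma.Site d)} (hJ : J ⊆ Λ) (hI : I.Nonempty)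
    {b : ℝ} (hb : 0 < b) (hbc : 4 * c⁻¹ ≤ b ^ 2) (t : ℕ) {S ρ₁ ρ₂ ρ₃ ρ₄ : ℝ} (hρ₄ : 0 ≤ ρ₄)
    (hbig : ρ₃ * b ^ (3 / 2 : ℝ) ≤ b ^ 2 / (2 * c⁻¹))
    (hlow : Real.exp (cumulantSum (gaussianFieldOfKernel K') (hamiltonian s D ϰ a J) t -
        (I.card : ℝ) * errTerm S ρ₁ ρ₂ ρ₃ ρ₄ (coefSup s D a J) b t) ≤
      ∫ z, cutoffBoltzmann (hamiltonian s D ϰ a J) I b z ∂gaussianFieldOfKernel K')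
    (hup : ∫ z, cutoffBoltzmann (hamiltonian s D ϰ a J) I b z ∂gaussianFieldOfKernel K' ≤
      Real.exp (cumulantSum (gaussianFieldOfKernel K') (hamiltonian s D ϰ a J) t +
        (I.card : ℝ) * errTerm S ρ₁ ρ₂ ρ₃ ρ₄ (coefSup s D a J) b t)) :
    Real.exp (cumulantSum (gaussianFieldOfKernel K) (hamiltonian s D ϰ a J) t -
          (I.card : ℝ) * errTerm (S + 4 * 8 ^ d) ρ₁ ρ₂ ρ₃ ρ₄ (coefSup s D a J) b t) ≤
        ∫ z, cutoffBoltzmann (hamiltonian s D ϰ a J) I b z ∂gaussianFieldOfKernel K ∧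
      ∫ z, cutoffBoltzmann (hamiltonian s D ϰ a J) I b z ∂gaussianFieldOfKernel K ≤
        Real.exp (cumulantSum (gaussianFieldOfKernel K) (hamiltonian s D ϰ a J) t +
          (I.card : ℝ) * errTerm (S + 4 * 8 ^ d) ρ₁ ρ₂ ρ₃ ρ₄ (coefSup s D a J) b t) := by
  classical
  have hAunit : IsUnit A.det := (Matrix.isUnit_iff_isUnit_det A).mp hApd.isUnit
  -- the collar kernel and the kernel-level hypotheses
  have hsum : ∀ x y, K' x y = K x y + (fun x y : B1Eq324BenfattoLemma.Site d => if x = y ∧ x ∈ Λ' ∧ x ∉ Λ then c⁻¹ else 0) x y :=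
    fun x y => kernel_collar_eq_add hΛ hAunit hc.ne' hAA hcross₁ hcross₂ hdiag hK hK' x y
  have hK0 : ∀ x y, (x ∉ Λ ∨ y ∉ Λ) → K x y = 0 := by
    intro x y hxy
    rw [hK]
    exact dif_neg fun h => hxy.elim (fun hx => hx h.1) (fun hy => hy h.2)
  have hKP0 : ∀ x y, (x ∉ Λ' \ Λ ∨ y ∉ Λ' \ Λ) →
      (fun x y : B1Eq324BenfattoLemma.Site d => if x = y ∧ x ∈ Λ' ∧ x ∉ Λ then c⁻¹ else 0) x y = 0 := by
    intro x y hxy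
    simp only
    refine if_neg fun h => ?_
    obtain ⟨rfl, hx', hxΛ⟩ := h
    exact hxy.elim (fun hx => hx (Finset.mem_sdiff.mpr ⟨hx', hxΛ⟩)) (fun hy => hy (Finset.mem_sdiff.mpr ⟨hx', hxΛ⟩))
  have hdisj : Disjoint Λ (Λ' \ Λ) := Finset.disjoint_sdiff
  have hKpsd : IsPosSemidefKernel K := isPosSemidefKernel_kernel hK hApd
  have hK'psd : IsPosSemidefKernel K' := isPosSemidefKernel_kernel hK' hA'pd
  have hKPpsd := isPosSemidefKernel_collarDiag (d := d) (Λ := Λ) (Λ' := Λ') hc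
  have hKPC : ∀ x, (fun x y : B1Eq324BenfattoLemma.Site d => if x = y ∧ x ∈ Λ' ∧ x ∉ Λ then c⁻¹ else 0) x x ≤ c⁻¹ := by
    intro x
    simp only
    split_ifs
    · exact le_rfl
    · exact inv_nonneg.mpr hc.le
  exact sandwich_of_collar_sandwich_errTerm hKpsd hK'psd hKPpsd hdisj hsum hK0 hKP0 (inv_pos.mpr hc) hKPC a hJ hI hb hbc t hρ₄ hbig hlow hup

end Package


end Literature.MathematicalPhysics.QuantumFieldTheory.Balaban1983to89.B1Eq324BenfattoClassCollar

end
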